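import Summits.ResolutionOfSingularities.ResolutionOfSingularities.Theorems.UniformComplexityCampaignW82TwistExponentNormalization
import Literature.AlgebraicGeometry.Resolution.SmoothStalksRegular
import Mathlib.AlgebraicGeometry.Morphisms.Smooth
import Mathlib.AlgebraicGeometry.Morphisms.FinitePresentation
import Mathlib.FieldTheory.IsAlgClosed.AlgebraicClosure
import HarnessLib

/-!
# [OURS · L1 W8.2] The twist-exponent witness, III: the curves `C_N` as schemes and the cusp over `P_1`

Cell `res-hironaka`, LADDER-RESOLUTION rung L (RESCUE), slot W8.2, door 2 (`UniformComplexity`, host item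
`PrimeModelTransfer` stmt-ResolutionOfSingularities-8933); prover res-L1-s82-pv-2 (gen 3). THESES-FREE module
(imports the siblings `…TwistExponentAlgebra` p505596 / `…TwistExponentNormalization` p507100, the tree's
`SmoothStalksRegular` (Stacks 056S: smooth over a field ⇒ regular local rings), Mathlib's `Smooth` /
`smoothLocus`, `HarnessLib`).

[OURS · L1 W8.2] Scheme-level packaging of the witness family and the KEY LOCAL FACT:
* `twistCurve K p t q N = Spec A_N` (`A_N = K[x,y]/(y^q − (x^p − t)^N)`), its structure morphism
  `twistCurveTo`, the normalisation morphism `normMor : C_1 ⟶ C_N` (Spec of `normMap`), the point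
  `cuspPoint` (`P_N : y = 0, x^p = t`);
* `exists_root_of_pow_eq_pow[_of_isIntegrallyClosed]` (Bezout: `y^q = g^N`, `gcd(q,N) = 1` ⇒ `w^q = g`,
  `w^N = y` for some `w`, lying in `R` if `R` is integrally closed);
* `valuationRing_stalk_cuspPoint`: `𝒪_{C_1,P_1}` is a valuation ring; `locallyOfFinitePresentation_twistCurveTo`;
* `false_of_smooth_nhd_cuspPoint`: **no open neighbourhood of `P_1` in `C_1 : w^q = x^p − t` is smooth over
  `K`** when `X^p − t` is irreducible — after base change to `K̄ ∋ τ = t^{1/p}` such a neighbourhood would be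
  smooth over `K̄`, hence regular at the point `(0, τ)` over `P_1`, which is the non-regular cusp of
  `w^q = (x − τ)^p` (`not_isRegularLocalRing_cusp`, Jacobian criterion). This is the scheme form of Kollár
  2007, 1.19 / the barrier `RegularNotGeometricallyRegular` («regular but not smooth at `(t^{1/p}, 0)`»).
Used by the sibling `…TwistExponentRigidity` (no smooth proper birational model of any `C_N`).

HONEST FRAMING. OURS negative-side bookkeeping; NOT a statement of H. Hironaka's 2017 manuscript ([Hironaka2017]);
nothing here is attributed to its author. AI work, weaker than expert review.

## References (vocabulary and locators only)
* J. Kollár, *Lectures on Resolution of Singularities* (2007), 1.19. [Kollar2007]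
* The Stacks Project, Tag 056S. [StacksProject]
-/

noncomputable section

set_option linter.dupNamespace false -- mandated namespace of this single-conjunct summit

open Polynomial
open scoped TensorProduct
open _root_.CategoryTheory _root_.CategoryTheory.Limits _root_.AlgebraicGeometry

namespace Summit.ResolutionOfSingularities.ResolutionOfSingularities.Theorems.CampaignW82.TwistExponent

section Rigidity
open Literature.AlgebraicGeometry.Resolution

variable (K : Type) [Field K] (p : ℕ) (t : K) (q : ℕ)

/-- The curve `C_N = Spec A_N`, `A_N = K[x,y]/(y^q − (x^p − t)^N)`. [folklore] -/
abbrev twistCurve (N : ℕ) : Scheme.{0} := Spec (.of (TwistRing K p t q N))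

/-- Its structure morphism to `Spec K`. [folklore] -/
abbrev twistCurveTo (N : ℕ) : twistCurve K p t q N ⟶ Spec (.of K) :=
  Spec.map (CommRingCat.ofHom (algebraMap K (TwistRing K p t q N)))

/-- The normalisation morphism `ν : C_1 ⟶ C_N` (`Spec` of `normMap`). [folklore] -/
abbrev normMor (N : ℕ) : twistCurve K p t q 1 ⟶ twistCurve K p t q N :=
  Spec.map (CommRingCat.ofHom (normMap K p t q N).toRingHom)

/-- `ν` is a morphism over `Spec K`. [folklore] -/
theorem normMor_comp_twistCurveTo (N : ℕ) :
    normMor K p t q N ≫ twistCurveTo K p t q N = twistCurveTo K p t q 1 := by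
  rw [← Spec.map_comp, ← CommRingCat.ofHom_comp]
  congr 2
  exact (normMap K p t q N).comp_algebraMap

/-- The point `P_N ∈ C_N` (`y = 0`, `x^p = t`). [folklore] -/
def cuspPoint [Fact q.Prime] (ht : Irreducible (X ^ p - C t : K[X])) {N : ℕ} (hN : 0 < N) :
    twistCurve K p t q N :=
  ⟨QIdeal K p t q N, QIdeal_isPrime K p t q ht hN⟩

/-! ## Bezout in a fraction field -/

/-- If `y^q = g^N` in a domain `R` with `q ≥ 1`, `gcd(q, N) = 1` and `g ≠ 0`, then some `w ∈ Frac R`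
satisfies `w^q = g` and `w^N = y` (namely `w = y^b g^a` with `aq + bN = 1`). [folklore] -/
theorem exists_root_of_pow_eq_pow {R : Type*} [CommRing R] [IsDomain R] {q N : ℕ} (hq : 0 < q)
    (hqN : q.Coprime N) {y g : R} (hyg : y ^ q = g ^ N) (hg : g ≠ 0) :
    ∃ w : FractionRing R, w ^ q = algebraMap R _ g ∧ w ^ N = algebraMap R _ y := by
  set F := FractionRing R
  have hy : y ≠ 0 := by
    rintro rfl
    rw [zero_pow hq.ne'] at hyg
    rcases Nat.eq_zero_or_pos N with rfl | hN
    · simp at hyg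
    · exact hg ((pow_eq_zero_iff hN.ne').mp hyg.symm)
  set Y : F := algebraMap R F y
  set G : F := algebraMap R F g
  have hY : Y ≠ 0 := IsFractionRing.to_map_ne_zero_of_mem_nonZeroDivisors (mem_nonZeroDivisors_of_ne_zero hy)
  have hG : G ≠ 0 := IsFractionRing.to_map_ne_zero_of_mem_nonZeroDivisors (mem_nonZeroDivisors_of_ne_zero hg)
  have hYG : Y ^ (q : ℤ) = G ^ (N : ℤ) := by rw [zpow_natCast, zpow_natCast, ← map_pow, ← map_pow, hyg]
  -- Bezout
  obtain ⟨a, b, hab⟩ : ∃ a b : ℤ, a * q + b * N = 1 := by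
    refine ⟨Nat.gcdA q N, Nat.gcdB q N, ?_⟩
    have := Nat.gcd_eq_gcd_ab q N
    rw [Nat.Coprime.gcd_eq_one hqN] at this
    push_cast at this
    linarith
  refine ⟨Y ^ b * G ^ a, ?_, ?_⟩
  · calc (Y ^ b * G ^ a) ^ q = (Y ^ (q : ℤ)) ^ b * G ^ (a * (q : ℤ)) := by
          rw [mul_pow, ← zpow_natCast (Y ^ b), ← zpow_natCast (G ^ a), ← zpow_mul, ← zpow_mul,
            mul_comm b, zpow_mul]
      _ = G ^ ((N : ℤ) * b + a * q) := by rw [hYG, ← zpow_mul, ← zpow_add₀ hG]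
      _ = G := by rw [show (N : ℤ) * b + a * q = 1 by linarith, zpow_one]
  · calc (Y ^ b * G ^ a) ^ N = Y ^ (b * (N : ℤ)) * (G ^ (N : ℤ)) ^ a := by
          rw [mul_pow, ← zpow_natCast (Y ^ b), ← zpow_natCast (G ^ a), ← zpow_mul, ← zpow_mul,
            mul_comm a, zpow_mul G]
      _ = Y ^ (b * (N : ℤ) + q * a) := by rw [← hYG, ← zpow_mul, ← zpow_add₀ hY]
      _ = Y := by rw [show b * (N : ℤ) + q * a = 1 by linarith, zpow_one]

/-- In an integrally closed domain, such a `w` lies in `R`. [folklore] -/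
theorem exists_root_of_pow_eq_pow_of_isIntegrallyClosed {R : Type*} [CommRing R] [IsDomain R]
    [IsIntegrallyClosed R] {q N : ℕ} (hq : 0 < q) (hqN : q.Coprime N) {y g : R} (hyg : y ^ q = g ^ N)
    (hg : g ≠ 0) : ∃ w : R, w ^ q = g ∧ w ^ N = y := by
  obtain ⟨w, hw1, hw2⟩ := exists_root_of_pow_eq_pow hq hqN hyg hg
  have hint : IsIntegral R w := by
    refine ⟨X ^ q - C g, monic_X_pow_sub_C g hq.ne', ?_⟩
    simp [hw1]
  obtain ⟨w₀, rfl⟩ := IsIntegrallyClosed.isIntegral_iff.mp hint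
  refine ⟨w₀, ?_, ?_⟩
  · apply IsFractionRing.injective R (FractionRing R)
    rw [map_pow]; exact hw1
  · apply IsFractionRing.injective R (FractionRing R)
    rw [map_pow]; exact hw2

/-! ## Stalks of the twist curves -/

/-- The local ring of `C_1` at `P_1` is a valuation ring (transport of
`valuationRing_cond_localization_QIdeal_one` along `𝒪_{Spec B, Q} ≅ B_Q`). [folklore] -/
theorem valuationRing_stalk_cuspPoint [Fact p.Prime] [hq : Fact q.Prime] (hqp : q ≠ p)
    (ht : Irreducible (X ^ p - C t : K[X])) :
    haveI : IsDomain (TwistRing K p t q 1) :=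
      isDomain_twistRing hqp (fun h => hq.out.ne_one (Nat.dvd_one.mp h))
    ValuationRing ((twistCurve K p t q 1).presheaf.stalk (cuspPoint K p t q ht Nat.one_pos)) := by
  haveI : IsDomain (TwistRing K p t q 1) :=
    isDomain_twistRing hqp (fun h => hq.out.ne_one (Nat.dvd_one.mp h))
  haveI := QIdeal_isPrime K p t q ht Nat.one_pos
  let e : ((twistCurve K p t q 1).presheaf.stalk (cuspPoint K p t q ht Nat.one_pos)) ≃+*
      Localization.AtPrime (QIdeal K p t q 1) :=
    (StructureSheaf.stalkIso (TwistRing K p t q 1) (cuspPoint K p t q ht Nat.one_pos)).toRingEquiv.symm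
  have hcond := valuationRing_cond_localization_QIdeal_one K p t q hqp ht
  refine { cond' := fun a b => ?_ }
  obtain ⟨c, hc⟩ := hcond (e a) (e b)
  refine ⟨e.symm c, ?_⟩
  rcases hc with hc | hc
  · left; apply e.injective; simpa using hc
  · right; apply e.injective; simpa using hc

/-- The structure morphism of `C_1` is locally of finite presentation. [folklore] -/
instance locallyOfFinitePresentation_twistCurveTo :
    LocallyOfFinitePresentation (twistCurveTo K p t q 1) := by
  rw [HasRingHomProperty.Spec_iff (P := @LocallyOfFinitePresentation), CommRingCat.hom_ofHom,
    RingHom.finitePresentation_algebraMap]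
  exact Algebra.FinitePresentation.quotient ⟨{twistPoly K p t q 1}, by simp⟩

/-! ## The cusp after base change: no smooth neighbourhood of `P_1` -/

/-- **No open neighbourhood of `P_1` in `C_1` is smooth over `K`** (when `X^p − t` is irreducible):
after base change to `L = K̄ ∋ τ = t^{1/p}`, the point `(0, τ)` of `C_{1,L}` over `P_1` has a
non-regular local ring (`not_isRegularLocalRing_cusp`), whereas an open smooth over `K` base-changes to
a scheme smooth over `L`, whose local rings are regular (Stacks 056S). [folklore] -/
theorem false_of_smooth_nhd_cuspPoint [hp : Fact p.Prime] [CharP K p] [Fact q.Prime]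
    (ht : Irreducible (X ^ p - C t : K[X])) (V : (twistCurve K p t q 1).Opens)
    (hQ : cuspPoint K p t q ht Nat.one_pos ∈ V) [Smooth (V.ι ≫ twistCurveTo K p t q 1)] : False := by
  let L : Type := AlgebraicClosure K
  obtain ⟨τ, hτ⟩ : ∃ τ : L, τ ^ p = algebraMap K L t := IsAlgClosed.exists_pow_nat_eq _ hp.out.pos
  let g : Spec (.of L) ⟶ Spec (.of K) := Spec.map (CommRingCat.ofHom (algebraMap K L))
  let f₁ := twistCurveTo K p t q 1
  let j := pullback.snd V.ι (pullback.fst f₁ g)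
  -- the open `V ×_K L ⊆ C_1 ×_K L` is smooth over `L`, hence has regular local rings
  have hWsm : Smooth (j ≫ pullback.snd f₁ g) := by
    rw [← pullbackRightPullbackFstIso_hom_snd f₁ g V.ι]
    infer_instance
  have hreg : ∀ w, IsRegularLocalRing ((pullback V.ι (pullback.fst f₁ g)).presheaf.stalk w) :=
    fun w => @isRegularLocalRing_stalk_of_smooth_of_field L _ _ (j ≫ pullback.snd f₁ g) hWsm w
  -- the cusp point of `C_1 ×_K L ≅ Spec (A_1 ⊗ L) ≅ Spec A_{1,L}`
  haveI := cuspIdeal_isPrime K p t q L τ hτ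
  let c₀ : Spec (.of (TwistRingExt K p t q L)) := ⟨cuspIdeal K p t q L τ, inferInstance⟩
  let eT : CommRingCat.of (TwistRing K p t q 1 ⊗[K] L) ≅ CommRingCat.of (TwistRingExt K p t q L) :=
    (tensorEquiv K p t q L).toCommRingCatIso
  let ι : Spec (.of (TwistRingExt K p t q L)) ⟶ pullback f₁ g :=
    Spec.map eT.hom ≫ (pullbackSpecIso K (TwistRing K p t q 1) L).inv
  let c₁ : ↥(pullback f₁ g) := ι.base c₀
  have hc₁ : (pullback.fst f₁ g).base c₁ = cuspPoint K p t q ht Nat.one_pos := by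
    have h1 : ι ≫ pullback.fst f₁ g =
        Spec.map (CommRingCat.ofHom (baseChangeHom K p t q L)) := by
      rw [Category.assoc, pullbackSpecIso_inv_fst, ← Spec.map_comp]
      congr 1
      rw [← tensorEquiv_comp_includeLeft]
      rfl
    change (ι ≫ pullback.fst f₁ g).base c₀ = _
    rw [h1]
    apply PrimeSpectrum.ext
    exact comap_baseChangeHom_cuspIdeal K p t q L τ ht hτ
  have hc₁r : c₁ ∈ Set.range j.base := by
    rw [Scheme.Pullback.range_snd]
    change (pullback.fst f₁ g).base c₁ ∈ Set.range V.ι.base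
    rw [Scheme.Opens.range_ι, hc₁]
    exact hQ
  obtain ⟨w, hw⟩ := hc₁r
  have hregc : IsRegularLocalRing ((pullback f₁ g).presheaf.stalk c₁) := by
    rw [← hw]
    haveI := hreg w
    exact IsRegularLocalRing.of_ringEquiv (asIso (j.stalkMap w)).commRingCatIsoToRingEquiv.symm
  have h0 : IsRegularLocalRing ((Spec (.of (TwistRingExt K p t q L))).presheaf.stalk c₀) := by
    haveI := hregc
    exact IsRegularLocalRing.of_ringEquiv (asIso (ι.stalkMap c₀)).commRingCatIsoToRingEquiv
  haveI : IsRegularLocalRing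
      ((AlgebraicGeometry.structurePresheafInCommRingCat (TwistRingExt K p t q L)).stalk c₀) := h0
  exact not_isRegularLocalRing_cusp K p t q L τ hτ
    (IsRegularLocalRing.of_ringEquiv
      (StructureSheaf.stalkIso (TwistRingExt K p t q L) c₀).toRingEquiv.symm)

end Rigidity

end Summit.ResolutionOfSingularities.ResolutionOfSingularities.Theorems.CampaignW82.TwistExponent

end
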